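import Summits.MatrixMultiplication.MatrixMultiplication.Theses.ThinBlockAlpha

/-!
# Candidate proof of STUB 1 `stub_chartSTPP` (CKSU 2005 Thm 37 in the tree threading) of line `tame-charts`
(refuter drefute seat; evidence for the lead — the shared first lemma of the chart programme)

Definitions are VERBATIM copies of `Cruxes/BoundedExponentThird/Lines/tame-charts.lean`; the proof of `chartSTPP_proof`
transplants textually into the skeleton (replace the `sorry` of `stub_chartSTPP`).
-/

set_option linter.dupNamespace false

namespace Summit.MatrixMultiplication.MatrixMultiplication.Cruxes.BoundedExponentThird.TameChartsStub1

open Finset Literature.Computability.AlgebraicComplexity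

/-- verbatim copy of `TameCharts.SymbolTPP`. -/
def SymbolTPP {Z : Type} [AddCommGroup Z] (A B C : Finset Z) : Prop :=
  ∀ a ∈ A, ∀ a' ∈ A, ∀ b ∈ B, ∀ b' ∈ B, ∀ c ∈ C, ∀ c' ∈ C,
    (a' - a) + (b' - b) + (c' - c) = 0 → a = a' ∧ b = b' ∧ c = c'

/-- verbatim copy of `TameCharts.Bad`. -/
def Bad {Z : Type} [AddCommGroup Z] {k : ℕ} (SA SB SC : Fin k → Finset Z) (x y z : Fin k) : Prop :=
  ∃ s' ∈ SA x, ∃ s ∈ SA z, ∃ t' ∈ SB y, ∃ t ∈ SB x, ∃ u' ∈ SC z, ∃ u ∈ SC y,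
    (s' - s) + (t' - t) + (u' - u) = 0

/-- verbatim copy of `TameCharts.block`. -/
def block {Z : Type} {k n : ℕ} (S : Fin k → Finset Z) (w : Fin n → Fin k) : Finset (Fin n → Z) :=
  Fintype.piFinset fun c => S (w c)

/-- verbatim copy of `TameCharts.IsLocalChartUSP`. -/
def IsLocalChartUSP {Z : Type} [AddCommGroup Z] {k : ℕ} (SA SB SC : Fin k → Finset Z) {n L : ℕ}
    (row : Fin L → Fin n → Fin k) : Prop :=
  ∀ i j l : Fin L, ¬ (i = j ∧ j = l) → ∃ c : Fin n, ¬ Bad SA SB SC (row i c) (row j c) (row l c)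

/-- **STUB 1** (`ChartSTPP` verbatim) — CKSU 2005 Thm. 37: over a chart of TPP symbols, every local chart-USP row family
yields an `IsSTPP` family of product blocks. -/
theorem chartSTPP_proof :
    ∀ (Z : Type) [AddCommGroup Z] (k : ℕ) (SA SB SC : Fin k → Finset Z),
      (∀ x, SymbolTPP (SA x) (SB x) (SC x)) →
      ∀ (n L : ℕ) (row : Fin L → Fin n → Fin k), IsLocalChartUSP SA SB SC row →
        IsSTPP (fun i => block SA (row i)) (fun i => block SB (row i)) (fun i => block SC (row i)) := by
  intro Z _ k SA SB SC hT n L row hU i j l s hs s' hs' t ht t' ht' u hu u' hu' heq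
  simp only [block, Fintype.mem_piFinset] at hs hs' ht ht' hu hu'
  have hc : ∀ c, (s' c - s c) + (t' c - t c) + (u' c - u c) = 0 := fun c => by
    have := congrFun heq c
    simpa using this
  have hijl : i = j ∧ j = l := by
    by_contra hne
    obtain ⟨c, hgood⟩ := hU i j l hne
    exact hgood ⟨s' c, hs' c, s c, hs c, t' c, ht' c, t c, ht c, u' c, hu' c, u c, hu c, hc c⟩
  obtain ⟨rfl, rfl⟩ := hijl
  have key : ∀ c, s c = s' c ∧ t c = t' c ∧ u c = u' c := fun c =>
    hT (row i c) (s c) (hs c) (s' c) (hs' c) (t c) (ht c) (t' c) (ht' c) (u c) (hu c) (u' c) (hu' c) (hc c)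
  exact ⟨rfl, rfl, funext fun c => (key c).1, funext fun c => (key c).2.1, funext fun c => (key c).2.2⟩

end Summit.MatrixMultiplication.MatrixMultiplication.Cruxes.BoundedExponentThird.TameChartsStub1
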